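import Literature.IUT.LogVolume.WeightDescentExpectation
import Literature.IUT.LogVolume.TensorPacketFactorIsoLattices
import Literature.NumberTheory.NumberFields.RescaledCompletionGaloisTransport
import HarnessLib

/-!
# The log-shell hull volume of the tensor packet `K_{w_0} ⊗ ⋯ ⊗ K_{w_j}` is GALOIS-INVARIANT, hence its
# `Pr_K`-average over `V(K)_p^{j+1}` equals its `Pr_{F_mod}`-average over the chosen section `V̲`

[IUTchI] Rmk. 3.1.5 (kurims p. 65): "`K` is Galois over `F_mod`" — so `Gal(K/F_mod)` permutes transitively the
places of `K` over each `v ∈ V_mod` (Cassels–Fröhlich VII Prop. 1.2 (ii)), and every Galois conjugation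
`σ_w : K_w ⥲ K_{σw}` is an isometric isomorphism of the (rescaled) completions (Cassels–Fröhlich VII §1.1;
tree: `RescaledCompletion.galAlgEquiv`, `norm_galAlgEquiv`). [IUTchIII] Prop. 3.9 (ii) (p. 116): the packet
log-volumes are "functorial" in the `𝒟^⊢`-prime-strips, i.e. depend only on the isometry classes of the
factors (tree: `TensorPacketFactorIso*`). [IUTchIV] Thm. 1.10 Step (v) (p. 28): the estimate is a weighted
average over tuples of places "with weights `[(F_mod)_v : ℚ_{v_ℚ}]`", the local fields being "`K_{v_i}`" for
`v_i ∈ V̲ ≅ V_mod`.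

THIS FILE assembles the three tree inputs (abc-iut-w5-d056: `WeightDescentExpectation`,
`RescaledCompletionGaloisTransport`, `TensorPacketFactorIsoLattices`) into the statement a `V(K)`-indexed
Θ-side computation needs in order to be read over the section `V̲`:

* `packetLogμ_packetHull_logShell_galois` — for `g⃗ ∈ Gal(K/F₀)^ι` and `w⃗ ∈ V(K)_p^ι`, the hull-volume of the
  log-shell of the packet `⊗_a K_{g_a w_a}` equals that of `⊗_a K_{w_a}` (both packets built from S7's
  `RescaledCompletion`, the carriers of c312-5's `kOf` AND of S2's `PlaceSection.localFields`);
* `packetLogμ_packetHull_logShell_fibreConst` — for `K/F₀` Galois it is constant on the fibres of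
  `w⃗ ↦ (w_a ∩ 𝓞_{F₀})_a`;
* `sum_prod_weight_mul_logShellHullVolume_eq_placeSection` — **for `K/F₀` Galois and any section
  `σ : PlaceSection F₀ K`: `Σ_{w⃗ ∈ V(K)_p^ι} Pr_K(w⃗)·H(w⃗) = Σ_{v⃗ ∈ V(F₀)_p^ι} Pr_{F₀}(v⃗)·H(v̲⃗)`**, where
  `H(w⃗) := log μ̄(hull(I_{w⃗}))`, and the same with any Galois-invariant additive term `A(w⃗)` (e.g. a function
  of the orders `ord_{w_a}(q)` of an `F₀`-rational quantity) — `sum_prod_weight_mul_add_logShellHullVolume_eq`.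

Classical bookkeeping about OUR objects (Galois theory of completions + Haar measure); PROOF-ONLY, no
definitions, no named facts; nothing here bears on the disputed [IUTchIII] Cor. 3.12 or takes a side.
[cite: Mochizuki2012, IUTchI Rmk. 3.1.5 p. 65] [cite: Mochizuki2012, IUTchIII Prop. 3.9 (ii) p. 116]
[cite: Mochizuki2012, IUTchIV Thm. 1.10 proof Step (v) p. 28] [cite: CasselsFrohlichANT1967, Ch. VII §1.1, Prop. 1.2 (ii)]
-/

noncomputable section

namespace Literature.IUT.LogVolume

open NumberField IsDedekindDomain Finset Literature.NumberTheory.Automorphic Literature.NumberTheory.NumberFields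
open scoped Pointwise

variable (F₀ K : Type) [Field F₀] [NumberField F₀] [Field K] [NumberField K] [Algebra F₀ K]
variable (p : ℕ) [Fact p.Prime]

omit [NumberField F₀] [Algebra F₀ K] in
variable {F₀} in
/-- A place of `K` over `p` contains `p`. [cite: NeukirchANT1999, Ch. I §8] -/
theorem natCast_mem_asIdeal_of_mem_placesOver {w : HeightOneSpectrum (𝓞 K)} (hw : w ∈ placesOver K p) :
    ((p : ℕ) : 𝓞 K) ∈ w.asIdeal := by
  have h := (mem_placesOver_iff w).mp hw
  have hmem : (p : ℤ) ∈ w.asIdeal.under ℤ := by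
    rw [← h.over]; exact Ideal.mem_span_singleton_self _
  simpa using Ideal.mem_comap.mp hmem

variable {ι : Type} [Fintype ι] [DecidableEq ι] [Nonempty ι]

/-- **Galois invariance of the log-shell hull volume of a tensor packet of completions**: for
`g⃗ ∈ Gal(K/F₀)^ι` and a tuple `w⃗` of places of `K` over `p`, `log μ̄(hull(I_{g⃗•w⃗})) = log μ̄(hull(I_{w⃗}))`
for the packets `⊗_a K_{g_a • w_a}` and `⊗_a K_{w_a}` of rescaled completions (the factorwise Galois
conjugations `σ_{w_a}` are isometric `ℚ_p`-algebra isomorphisms, and the packet quantities are transported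
along them). [cite: Mochizuki2012, IUTchIII Prop. 3.9 (ii) p. 116] [cite: CasselsFrohlichANT1967, Ch. VII §1.1] -/
theorem packetLogμ_packetHull_logShell_galois (g : ι → (K ≃ₐ[F₀] K)) (w : ι → placesOver K p) :
    packetLogμ p (fun a => RescaledCompletion K p (g a • (w a).1)
        (natCast_mem_asIdeal_of_mem_placesOver K p (smul_mem_placesOver F₀ K (g a) (w a).2)))
      (packetHull p _ (logShell p _)) =
    packetLogμ p (fun a => RescaledCompletion K p (w a).1 (natCast_mem_asIdeal_of_mem_placesOver K p (w a).2))
      (packetHull p _ (logShell p _)) :=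
  packetLogμ_packetHull_logShell_factor p
    (fun a => RescaledCompletion K p (w a).1 (natCast_mem_asIdeal_of_mem_placesOver K p (w a).2))
    (fun a => RescaledCompletion K p (g a • (w a).1)
        (natCast_mem_asIdeal_of_mem_placesOver K p (smul_mem_placesOver F₀ K (g a) (w a).2)))
    (fun a => RescaledCompletion.galAlgEquiv (g a) rfl _ _)
    (fun a x => RescaledCompletion.norm_galAlgEquiv (g a) rfl _ _ x)

/-- The same for the unscaled lattice `log_p(R_I^×)`: `log μ̄(hull(log_p(R^×_{g⃗•w⃗}))) = log μ̄(hull(log_p(R^×_{w⃗})))`.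
[cite: Mochizuki2012, IUTchIII Prop. 3.9 (ii) p. 116] [cite: Mochizuki2012, IUTchIV Prop. 1.2 p. 10] -/
theorem packetLogμ_packetHull_logPacket_galois (g : ι → (K ≃ₐ[F₀] K)) (w : ι → placesOver K p) :
    packetLogμ p (fun a => RescaledCompletion K p (g a • (w a).1)
        (natCast_mem_asIdeal_of_mem_placesOver K p (smul_mem_placesOver F₀ K (g a) (w a).2)))
      (packetHull p _ (logPacket p (fun a => RescaledCompletion K p (g a • (w a).1)
        (natCast_mem_asIdeal_of_mem_placesOver K p (smul_mem_placesOver F₀ K (g a) (w a).2))) :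
          Set (PacketAlgebra p (fun a => RescaledCompletion K p (g a • (w a).1)
        (natCast_mem_asIdeal_of_mem_placesOver K p (smul_mem_placesOver F₀ K (g a) (w a).2)))))) =
    packetLogμ p (fun a => RescaledCompletion K p (w a).1 (natCast_mem_asIdeal_of_mem_placesOver K p (w a).2))
      (packetHull p _ (logPacket p (fun a => RescaledCompletion K p (w a).1 (natCast_mem_asIdeal_of_mem_placesOver K p (w a).2)) :
          Set (PacketAlgebra p (fun a => RescaledCompletion K p (w a).1 (natCast_mem_asIdeal_of_mem_placesOver K p (w a).2))))) :=
  packetLogμ_packetHull_logPacket_factor p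
    (fun a => RescaledCompletion K p (w a).1 (natCast_mem_asIdeal_of_mem_placesOver K p (w a).2))
    (fun a => RescaledCompletion K p (g a • (w a).1)
        (natCast_mem_asIdeal_of_mem_placesOver K p (smul_mem_placesOver F₀ K (g a) (w a).2)))
    (fun a => RescaledCompletion.galAlgEquiv (g a) rfl _ _)
    (fun a x => RescaledCompletion.norm_galAlgEquiv (g a) rfl _ _ x)

/-- **For `K/F₀` Galois, the log-shell hull volume `H(w⃗) = log μ̄(hull(I_{w⃗}))` is constant on the fibres of
`w⃗ ↦ (w_a ∩ 𝓞_{F₀})_a`** (transitivity of `Gal(K/F₀)` on the places over a given place of `F₀`).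
[cite: CasselsFrohlichANT1967, Ch. VII Prop. 1.2 (ii)] [cite: Mochizuki2012, IUTchIII Prop. 3.9 (ii) p. 116] -/
theorem packetLogμ_packetHull_logShell_fibreConst [IsGalois F₀ K] (w w' : ι → placesOver K p)
    (h : ∀ a, finBelow F₀ K (w a).1 = finBelow F₀ K (w' a).1) :
    packetLogμ p (fun a => RescaledCompletion K p (w a).1 (natCast_mem_asIdeal_of_mem_placesOver K p (w a).2))
      (packetHull p _ (logShell p _)) =
    packetLogμ p (fun a => RescaledCompletion K p (w' a).1 (natCast_mem_asIdeal_of_mem_placesOver K p (w' a).2))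
      (packetHull p _ (logShell p _)) :=
  fibreConst_of_smul_invariant F₀ K
    (fun w : ι → placesOver K p =>
      packetLogμ p (fun a => RescaledCompletion K p (w a).1 (natCast_mem_asIdeal_of_mem_placesOver K p (w a).2))
        (packetHull p _ (logShell p _)))
    (fun g w => packetLogμ_packetHull_logShell_galois F₀ K p g w) w w' h

open scoped Classical in
/-- **Descent of the log-shell hull volumes to the section** ([IUTchIV] Thm. 1.10 Step (v) read over
`V̲ ≅ V_mod`): for `K/F₀` Galois and `σ : PlaceSection F₀ K`,
`Σ_{w⃗ ∈ V(K)_p^ι} Pr_K(w⃗)·H(w⃗) = Σ_{v⃗ ∈ V(F₀)_p^ι} Pr_{F₀}(v⃗)·H(v̲⃗)`, `H(w⃗) = log μ̄(hull(I_{w⃗}))`.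
[cite: Mochizuki2012, IUTchIV Thm. 1.10 proof Step (v) p. 28] [cite: Mochizuki2012, IUTchI Rmk. 3.1.5 p. 65] -/
theorem sum_prod_weight_mul_logShellHullVolume_eq_placeSection [IsGalois F₀ K] (σ : PlaceSection F₀ K) :
    ∑ w : ι → placesOver K p, (∏ a, weight K (w a).1) *
        packetLogμ p (fun a => RescaledCompletion K p (w a).1 (natCast_mem_asIdeal_of_mem_placesOver K p (w a).2))
          (packetHull p _ (logShell p _)) =
      ∑ v : ι → placesOver F₀ p, (∏ a, weight F₀ (v a).1) *
        packetLogμ p (fun a => RescaledCompletion K p (σ.lift (v a).1)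
            (natCast_mem_asIdeal_of_mem_placesOver K p (σ.lift_mem_placesOver (v a))))
          (packetHull p _ (logShell p _)) :=
  sum_prod_weight_mul_eq_of_smul_invariant_placeSection F₀ K σ
    (fun w : ι → placesOver K p =>
      packetLogμ p (fun a => RescaledCompletion K p (w a).1 (natCast_mem_asIdeal_of_mem_placesOver K p (w a).2))
        (packetHull p _ (logShell p _)))
    (fun g w => packetLogμ_packetHull_logShell_galois F₀ K p g w)

open scoped Classical in
/-- **Descent with a Galois-invariant additive term** (the shape `c(w⃗) = A(w⃗) + H(w⃗)` of a per-summand content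
bound, `A(w⃗)` e.g. `−m(w⃗)·log p` with `m` read off Galois-invariant order data): for `K/F₀` Galois, `A`
invariant under the componentwise `Gal(K/F₀)^ι`-action and `σ : PlaceSection F₀ K`,
`Σ_{w⃗} Pr_K(w⃗)·(A(w⃗) + H(w⃗)) = Σ_{v⃗} Pr_{F₀}(v⃗)·(A(v̲⃗) + H(v̲⃗))`.
[cite: Mochizuki2012, IUTchIV Thm. 1.10 proof Step (v) p. 28] [cite: Mochizuki2012, IUTchI Rmk. 3.1.5 p. 65] -/
theorem sum_prod_weight_mul_add_logShellHullVolume_eq [IsGalois F₀ K] (σ : PlaceSection F₀ K)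
    (A : (ι → placesOver K p) → ℝ)
    (hA : ∀ (g : ι → (K ≃ₐ[F₀] K)) (w : ι → placesOver K p),
      A (fun a => ⟨g a • (w a).1, smul_mem_placesOver F₀ K (g a) (w a).2⟩) = A w) :
    ∑ w : ι → placesOver K p, (∏ a, weight K (w a).1) *
        (A w + packetLogμ p (fun a => RescaledCompletion K p (w a).1 (natCast_mem_asIdeal_of_mem_placesOver K p (w a).2))
          (packetHull p _ (logShell p _))) =
      ∑ v : ι → placesOver F₀ p, (∏ a, weight F₀ (v a).1) *
        (A (fun a => ⟨σ.lift (v a).1, σ.lift_mem_placesOver (v a)⟩) +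
          packetLogμ p (fun a => RescaledCompletion K p (σ.lift (v a).1)
              (natCast_mem_asIdeal_of_mem_placesOver K p (σ.lift_mem_placesOver (v a))))
            (packetHull p _ (logShell p _))) :=
  sum_prod_weight_mul_eq_of_smul_invariant_placeSection F₀ K σ
    (fun w : ι → placesOver K p =>
      A w + packetLogμ p (fun a => RescaledCompletion K p (w a).1 (natCast_mem_asIdeal_of_mem_placesOver K p (w a).2))
        (packetHull p _ (logShell p _)))
    (fun g w => by rw [hA g w, packetLogμ_packetHull_logShell_galois F₀ K p g w])

open scoped Classical in
/-- **The same descent for the UNSCALED lattice** `Λ_{w⃗} = log_p(R^×_{w⃗})` — the summand shape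
`−m·log p + log μ̄(hull(Λ))` of a per-summand content bound (tree: c312-3's `negLogThetaDH_ofInput_eq_of_content`,
s2-p7's `Cor312Vol.thetaLocal_untopD_le_sum_content_hull`): for `K/F₀` Galois, a Galois-invariant additive term
`A` and `σ : PlaceSection F₀ K`,
`Σ_{w⃗} Pr_K(w⃗)·(A(w⃗) + log μ̄(hull(Λ_{w⃗}))) = Σ_{v⃗} Pr_{F₀}(v⃗)·(A(v̲⃗) + log μ̄(hull(Λ_{v̲⃗})))`.
[cite: Mochizuki2012, IUTchIV Thm. 1.10 proof Step (v) p. 28] [cite: Mochizuki2012, IUTchI Rmk. 3.1.5 p. 65] -/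
theorem sum_prod_weight_mul_add_logPacketHullVolume_eq [IsGalois F₀ K] (σ : PlaceSection F₀ K)
    (A : (ι → placesOver K p) → ℝ)
    (hA : ∀ (g : ι → (K ≃ₐ[F₀] K)) (w : ι → placesOver K p),
      A (fun a => ⟨g a • (w a).1, smul_mem_placesOver F₀ K (g a) (w a).2⟩) = A w) :
    ∑ w : ι → placesOver K p, (∏ a, weight K (w a).1) *
        (A w + packetLogμ p (fun a => RescaledCompletion K p (w a).1 (natCast_mem_asIdeal_of_mem_placesOver K p (w a).2))
          (packetHull p _ (logPacket p (fun a => RescaledCompletion K p (w a).1 (natCast_mem_asIdeal_of_mem_placesOver K p (w a).2)) :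
          Set (PacketAlgebra p (fun a => RescaledCompletion K p (w a).1 (natCast_mem_asIdeal_of_mem_placesOver K p (w a).2)))))) =
      ∑ v : ι → placesOver F₀ p, (∏ a, weight F₀ (v a).1) *
        (A (fun a => ⟨σ.lift (v a).1, σ.lift_mem_placesOver (v a)⟩) +
          packetLogμ p (fun a => RescaledCompletion K p (σ.lift (v a).1)
              (natCast_mem_asIdeal_of_mem_placesOver K p (σ.lift_mem_placesOver (v a))))
            (packetHull p _ (logPacket p (fun a => RescaledCompletion K p (σ.lift (v a).1)
              (natCast_mem_asIdeal_of_mem_placesOver K p (σ.lift_mem_placesOver (v a)))) :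
          Set (PacketAlgebra p (fun a => RescaledCompletion K p (σ.lift (v a).1)
              (natCast_mem_asIdeal_of_mem_placesOver K p (σ.lift_mem_placesOver (v a)))))))) :=
  sum_prod_weight_mul_eq_of_smul_invariant_placeSection F₀ K σ
    (fun w : ι → placesOver K p =>
      A w + packetLogμ p (fun a => RescaledCompletion K p (w a).1 (natCast_mem_asIdeal_of_mem_placesOver K p (w a).2))
        (packetHull p _ (logPacket p (fun a => RescaledCompletion K p (w a).1 (natCast_mem_asIdeal_of_mem_placesOver K p (w a).2)) :
          Set (PacketAlgebra p (fun a => RescaledCompletion K p (w a).1 (natCast_mem_asIdeal_of_mem_placesOver K p (w a).2))))))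
    (fun g w => by rw [hA g w, packetLogμ_packetHull_logPacket_galois F₀ K p g w])

/-- **Any region transported by the factorwise Galois conjugations has Galois-invariant `log μ̄`** — the form
needed for regions other than the log-shell (e.g. the hull of the union of the indeterminacy-images of a pilot
region, once that union is known to correspond under `⊗ σ_{w_a}`): for a family of regions `R(w⃗) ⊆ ⊗_a K_{w_a}`
with `(⊗_a σ_{w_a})(R(w⃗)) = R(g⃗•w⃗)`, `log μ̄(R(g⃗•w⃗)) = log μ̄(R(w⃗))`.
[cite: Mochizuki2012, IUTchIII Prop. 3.9 (ii) p. 116] [cite: CasselsFrohlichANT1967, Ch. VII §1.1] -/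
theorem packetLogμ_galois_of_image_eq (g : ι → (K ≃ₐ[F₀] K)) (w : ι → placesOver K p)
    (R : Set (PacketAlgebra p
      (fun a => RescaledCompletion K p (w a).1 (natCast_mem_asIdeal_of_mem_placesOver K p (w a).2))))
    (R' : Set (PacketAlgebra p
      (fun a => RescaledCompletion K p (g a • (w a).1)
        (natCast_mem_asIdeal_of_mem_placesOver K p (smul_mem_placesOver F₀ K (g a) (w a).2)))))
    (hR : factorAlgEquiv p
        (fun a => RescaledCompletion K p (w a).1 (natCast_mem_asIdeal_of_mem_placesOver K p (w a).2))
        (fun a => RescaledCompletion K p (g a • (w a).1)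
          (natCast_mem_asIdeal_of_mem_placesOver K p (smul_mem_placesOver F₀ K (g a) (w a).2)))
        (fun a => RescaledCompletion.galAlgEquiv (g a) rfl _ _) '' R = R') :
    packetLogμ p _ R' = packetLogμ p _ R := by
  rw [← hR, packetLogμ_image_factor]

end Literature.IUT.LogVolume

end
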